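import Literature.NumberTheory.Transcendental.ComplexFormsPullback
import Literature.NumberTheory.Transcendental.DolbeaultProofs
import Literature.Geometry.Kaehler.ManifoldFormsPullback
import HarnessLib

/-!
# `∂̄` and holomorphic pull-backs; biholomorphic invariance of `H^{p,q}_{∂̄} = 0`

* `weightComponent_pullback`, `typeComponent_pullback` — the `U(1)`-weight / `(p,q)`-type
  components of a complex form commute with pull-back along a holomorphic map (its differential is
  `ℂ`-linear, so it commutes with the rotations `e^{iθ}`; Voisin (2002), §7.3.2);
* `dolbeaultBar_pullback_of_isOfType` — `∂̄(f^*α) = f^*(∂̄α)` for a smooth form `α` of pure type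
  and a holomorphic `f` (Voisin (2002), §2.3.3 / Huybrechts (2005), Lemma 2.6.23: `∂̄` is natural
  for holomorphic maps), through the tree's `IsOfType.dolbeaultBar_eq` and `mextDeriv_pullback`;
* `subsingleton_dolbeaultCohomology_of_leftInverse` — **Theorem.** if `f : M → N` and `g : N → M`
  are holomorphic (and real-`C^∞`) with `g ∘ f = id`, then `H^{p,q+1}_{∂̄}(N) = 0` implies
  `H^{p,q+1}_{∂̄}(M) = 0` (closed forms `α` on `M` are `f^*g^*α`, `g^*α` is closed on `N`, and
  `f^*` maps `∂̄`-exact forms to `∂̄`-exact forms); in particular the vanishing of Dolbeault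
  cohomology is a biholomorphic invariant;
* `subsingleton_dolbeaultCohomology_top_of_equiv` — transport of `H^{p,q+1}_{∂̄}(E') = 0` along a
  continuous `ℂ`-linear equivalence `E ≃L[ℂ] E'` of the model spaces (whole spaces as `⊤ : Opens`).

## References

* C. Voisin, *Hodge Theory and Complex Algebraic Geometry I* (2002), §2.3.3, §7.3.2.
  [VoisinHodgeI2002]
* D. Huybrechts, *Complex Geometry* (2005), §2.6 (naturality of `∂̄`). [HuybrechtsCG2005]
-/

noncomputable section

open scoped Manifold ContDiff Topology
open Set Function
open Literature.Geometry.Kaehler Literature.NumberTheory.Transcendental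

namespace Literature.Analysis.Complex

variable {E : Type*} [NormedAddCommGroup E] [NormedSpace ℂ E]
  {E' : Type*} [NormedAddCommGroup E'] [NormedSpace ℂ E']
  {M : Type*} [TopologicalSpace M] [ChartedSpace E M]
  {N : Type*} [TopologicalSpace N] [ChartedSpace E' N]

/-! ### Type components and holomorphic pull-backs -/

section Components

variable {k : ℕ}

/-- **Weight components commute with holomorphic pull-back**: `(f^*α)_w = f^*(α_w)`, because the
differential of a holomorphic map commutes with the rotations `e^{iθ}` of the tangent spaces
(`mfderiv_real_apply_smul`). [cite: VoisinHodgeI2002, §7.3.2] -/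
theorem weightComponent_pullback (w : ℤ) (α : MForm 𝓘(ℝ, E') N ℂ k) {f : M → N}
    (hf : MDifferentiable 𝓘(ℂ, E) 𝓘(ℂ, E') f) :
    (α.pullback 𝓘(ℝ, E) f).weightComponent w = (α.weightComponent w).pullback 𝓘(ℝ, E) f := by
  funext x
  have key : ∀ (θ : ℝ) (v : TangentSpace 𝓘(ℝ, E) x),
      mfderiv 𝓘(ℝ, E) 𝓘(ℝ, E') f x (tangentRotate E x θ v) =
        tangentRotate E' (f x) θ (mfderiv 𝓘(ℝ, E) 𝓘(ℝ, E') f x v) := fun θ v =>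
    mfderiv_real_apply_smul (hf x) _ v
  ext v
  simp only [MForm.weightComponent, MForm.pullback_apply, ContinuousAlternatingMap.smul_apply,
    ContinuousAlternatingMap.sum_apply, ContinuousAlternatingMap.compContinuousLinearMap_apply,
    Function.comp_def, key]

/-- **`(p,q)`-components commute with holomorphic pull-back**: `(f^*α)^{p,q} = f^*(α^{p,q})`
(Voisin (2002), §7.3.2). [cite: VoisinHodgeI2002, §7.3.2] -/
theorem typeComponent_pullback (p q : ℕ) (α : MForm 𝓘(ℝ, E') N ℂ k) {f : M → N}
    (hf : MDifferentiable 𝓘(ℂ, E) 𝓘(ℂ, E') f) :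
    (α.pullback 𝓘(ℝ, E) f).typeComponent p q = (α.typeComponent p q).pullback 𝓘(ℝ, E) f := by
  unfold MForm.typeComponent
  split_ifs
  · exact weightComponent_pullback _ α hf
  · exact (MForm.pullback_zero (I := 𝓘(ℝ, E)) f).symm

end Components

/-! ### `∂̄` commutes with holomorphic pull-back on forms of pure type -/

section Dbar

variable [IsManifold 𝓘(ℝ, E) ∞ M] [IsManifold 𝓘(ℝ, E') ∞ N] {k : ℕ}

/-- **Naturality of `∂̄` for holomorphic maps** on smooth forms of pure type `(p,q)`:
`∂̄(f^*α) = f^*(∂̄α)` (`∂̄α = (dα)^{p,q+1}`, `d` is natural and the type components commute with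
holomorphic pull-back; Voisin (2002), §2.3.3; Huybrechts (2005), §2.6).
[cite: VoisinHodgeI2002, §2.3.3] -/
theorem dolbeaultBar_pullback_of_isOfType {p q : ℕ} {α : MForm 𝓘(ℝ, E') N ℂ k} (hα : IsOfType p q α)
    (hs : IsSmoothForm α) {f : M → N} (hfc : MDifferentiable 𝓘(ℂ, E) 𝓘(ℂ, E') f)
    (hfr : ContMDiff 𝓘(ℝ, E) 𝓘(ℝ, E') ∞ f) :
    dolbeaultBar (α.pullback 𝓘(ℝ, E) f) = (dolbeaultBar α).pullback 𝓘(ℝ, E) f := by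
  rw [IsOfType.dolbeaultBar_eq_holds (hα.pullback hfc), IsOfType.dolbeaultBar_eq_holds hα,
    mextDeriv_pullback hfr hs, typeComponent_pullback _ _ _ hfc]

/-- Pull-back along a holomorphic (and real-`C^∞`) map sends smooth `(p,q)`-forms to smooth
`(p,q)`-forms. [cite: VoisinHodgeI2002, §7.3.2] -/
theorem pullback_mem_pqForms {p q : ℕ} {γ : MForm 𝓘(ℝ, E') N ℂ (p + q)} (hγ : γ ∈ pqForms E' N p q)
    {f : M → N} (hfc : MDifferentiable 𝓘(ℂ, E) 𝓘(ℂ, E') f) (hfr : ContMDiff 𝓘(ℝ, E) 𝓘(ℝ, E') ∞ f) :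
    γ.pullback 𝓘(ℝ, E) f ∈ pqForms E M p q := by
  rw [mem_pqForms_iff] at hγ ⊢
  exact ⟨isSmoothForm_pullback hfr hγ.1, hγ.2.pullback hfc⟩

/-- Pull-back along a holomorphic (and real-`C^∞`) map sends `∂̄`-exact forms to `∂̄`-exact forms:
`f^*(B^{p,q+1}_{∂̄}(N)) ⊆ B^{p,q+1}_{∂̄}(M)`. [cite: VoisinHodgeI2002, §7.3.2] -/
theorem pullback_mem_dolbeaultExactForms {p q : ℕ} {β : MForm 𝓘(ℝ, E') N ℂ (p + (q + 1))}
    (hβ : β ∈ dolbeaultExactForms E' N p (q + 1)) {f : M → N}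
    (hfc : MDifferentiable 𝓘(ℂ, E) 𝓘(ℂ, E') f) (hfr : ContMDiff 𝓘(ℝ, E) 𝓘(ℝ, E') ∞ f) :
    β.pullback 𝓘(ℝ, E) f ∈ dolbeaultExactForms E M p (q + 1) := by
  simp only [dolbeaultExactForms] at hβ ⊢
  refine Submodule.span_induction ?_ ?_ ?_ ?_ hβ
  · rintro _ ⟨γ, hγ, rfl⟩
    refine Submodule.subset_span ⟨γ.pullback 𝓘(ℝ, E) f, pullback_mem_pqForms hγ hfc hfr, ?_⟩
    obtain ⟨hγs, hγt⟩ := (mem_pqForms_iff γ).1 hγ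
    exact dolbeaultBar_pullback_of_isOfType hγt hγs hfc hfr
  · rw [MForm.pullback_zero]
    exact Submodule.zero_mem _
  · intro a b _ _ ha hb
    rw [MForm.pullback_add]
    exact Submodule.add_mem _ ha hb
  · intro c a _ ha
    have : (c • a).pullback 𝓘(ℝ, E) f = c • a.pullback 𝓘(ℝ, E) f := by
      funext x; ext v; simp [MForm.pullback_apply]
    rw [this]
    exact Submodule.smul_mem _ c ha

/-- **Biholomorphic invariance of the vanishing of Dolbeault cohomology** (in the form needed: a
holomorphic map `f : M → N` with a holomorphic left inverse `g`): if `H^{p,q+1}_{∂̄}(N) = 0` then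
`H^{p,q+1}_{∂̄}(M) = 0`. Proof: a `∂̄`-closed smooth `(p,q+1)`-form `α` on `M` is `f^*(g^*α)`;
`g^*α` is `∂̄`-closed on `N`, hence `∂̄`-exact, and `f^*` preserves `∂̄`-exactness
(`pullback_mem_dolbeaultExactForms`). [cite: VoisinHodgeI2002, §7.3.2] -/
theorem subsingleton_dolbeaultCohomology_of_leftInverse {p q : ℕ} {f : M → N} {g : N → M}
    (hfc : MDifferentiable 𝓘(ℂ, E) 𝓘(ℂ, E') f) (hfr : ContMDiff 𝓘(ℝ, E) 𝓘(ℝ, E') ∞ f)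
    (hgc : MDifferentiable 𝓘(ℂ, E') 𝓘(ℂ, E) g) (hgr : ContMDiff 𝓘(ℝ, E') 𝓘(ℝ, E) ∞ g)
    (hgf : LeftInverse g f) (hN : Subsingleton (dolbeaultCohomology E' N p (q + 1))) :
    Subsingleton (dolbeaultCohomology E M p (q + 1)) := by
  -- on `N`: every `∂̄`-closed smooth `(p,q+1)`-form is `∂̄`-exact
  have hN' : ∀ z ∈ dolbeaultClosedForms E' N p (q + 1), z ∈ dolbeaultExactForms E' N p (q + 1) := by
    intro z hz
    unfold dolbeaultCohomology at hN
    rw [Submodule.Quotient.subsingleton_iff] at hN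
    have : (⟨z, hz⟩ : dolbeaultClosedForms E' N p (q + 1)) ∈
        (dolbeaultExactForms E' N p (q + 1)).comap (dolbeaultClosedForms E' N p (q + 1)).subtype := by
      rw [hN]; trivial
    simpa using this
  unfold dolbeaultCohomology
  rw [Submodule.Quotient.subsingleton_iff, eq_top_iff]
  rintro ⟨z, hz⟩ -
  rw [Submodule.mem_comap, Submodule.subtype_apply]
  refine Submodule.span_le.2 ?_ hz
  rintro α ⟨hs, ht, hc⟩
  -- `α = f^*(g^*α)` and `g^*α` is `∂̄`-closed on `N`
  have hgα : α.pullback 𝓘(ℝ, E') g ∈ dolbeaultClosedForms E' N p (q + 1) :=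
    Submodule.subset_span ⟨isSmoothForm_pullback hgr hs, ht.pullback hgc, by
      rw [dolbeaultBar_pullback_of_isOfType ht hs hgc hgr, hc, MForm.pullback_zero]⟩
  have hα : α = (α.pullback 𝓘(ℝ, E') g).pullback 𝓘(ℝ, E) f := by
    rw [← MForm.pullback_comp (hgr.mdifferentiable (by simp)) (hfr.mdifferentiable (by simp)),
      hgf.comp_eq_id, MForm.pullback_id]
  rw [hα]
  exact pullback_mem_dolbeaultExactForms (hN' _ hgα) hfc hfr

end Dbar

/-! ### Whole spaces related by a linear equivalence -/

section Equiv

/-- The map of whole spaces (as the open submanifolds `⊤`) induced by a map of the model spaces.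
[folklore] -/
def opensTopMap (φ : E → E') : (⊤ : TopologicalSpace.Opens E) → (⊤ : TopologicalSpace.Opens E') :=
  fun x => ⟨φ x, trivial⟩

omit [NormedSpace ℂ E] [NormedSpace ℂ E'] in
/-- Values of `opensTopMap`. [folklore] -/
@[simp]
theorem coe_opensTopMap (φ : E → E') (x : (⊤ : TopologicalSpace.Opens E)) : (opensTopMap φ x : E') = φ x :=
  rfl

/-- `opensTopMap φ` is complex-`C^∞` if `φ` is. [folklore] -/
theorem contMDiff_opensTopMap {φ : E → E'} (hφ : ContMDiff 𝓘(ℂ, E) 𝓘(ℂ, E') ∞ φ) :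
    ContMDiff 𝓘(ℂ, E) 𝓘(ℂ, E') ∞ (opensTopMap φ) := fun x =>
  (ContMDiffAt.subtypeVal_comp_iff ⊤ (opensTopMap φ) x).1
    ((contMDiffAt_subtype_iff (U := ⊤) (f := φ)).2 hφ.contMDiffAt)

/-- `opensTopMap φ` is real-`C^∞` if `φ` is. [folklore] -/
theorem contMDiff_real_opensTopMap {φ : E → E'} (hφ : ContMDiff 𝓘(ℝ, E) 𝓘(ℝ, E') ∞ φ) :
    ContMDiff 𝓘(ℝ, E) 𝓘(ℝ, E') ∞ (opensTopMap φ) := fun x =>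
  (ContMDiffAt.subtypeVal_comp_iff ⊤ (opensTopMap φ) x).1
    ((contMDiffAt_subtype_iff (U := ⊤) (f := φ)).2 hφ.contMDiffAt)

/-- **`H^{p,q+1}_{∂̄}` of whole spaces is invariant under continuous linear equivalences**: if
`H^{p,q+1}_{∂̄}(E') = 0` (whole space as the open submanifold `⊤`) and `E ≃L[ℂ] E'`, then
`H^{p,q+1}_{∂̄}(E) = 0`. [cite: VoisinHodgeI2002, §7.3.2] -/
theorem subsingleton_dolbeaultCohomology_top_of_equiv (Φ : E ≃L[ℂ] E') {p q : ℕ}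
    (h : Subsingleton (dolbeaultCohomology E' (⊤ : TopologicalSpace.Opens E') p (q + 1))) :
    Subsingleton (dolbeaultCohomology E (⊤ : TopologicalSpace.Opens E) p (q + 1)) :=
  subsingleton_dolbeaultCohomology_of_leftInverse (f := opensTopMap (Φ : E → E')) (g := opensTopMap (Φ.symm : E' → E))
    ((contMDiff_opensTopMap (Φ : E →L[ℂ] E').contMDiff).mdifferentiable (by simp))
    (contMDiff_real_opensTopMap ((Φ : E →L[ℂ] E').restrictScalars ℝ).contMDiff)
    ((contMDiff_opensTopMap (Φ.symm : E' →L[ℂ] E).contMDiff).mdifferentiable (by simp))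
    (contMDiff_real_opensTopMap ((Φ.symm : E' →L[ℂ] E).restrictScalars ℝ).contMDiff)
    (fun x => Subtype.ext (Φ.symm_apply_apply x.1)) h

end Equiv

end Literature.Analysis.Complex
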